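import Summits.NavierStokesRegularity.FluidComputer.DampedTransitionWindow
import Summits.NavierStokesRegularity.FluidComputer.ViscousConjugacy
import Literature.Analysis.FluidPDE.Tao2016AveragedNS.ReachScaling

/-!
# Tao's delay gate under NON-UNIFORM diagonal damping, part 4: constant rates `dᵢ ∈ [μ, μ + Δ]` in
# ORIGINAL time — the quiet phase through the viscous clock

Companion file of `DampedTransition.lean`, `DampedTransitionQuiet.lean`, `DampedTransitionWindow.lean`
(cell `pub-fluidc`, seat bp1; same namespace `Summit.NavierStokesRegularity.FluidComputer.DampedTransition`).
HONEST FRAMING (verbatim): low prior, high value-of-information experiment on Tao's machine paradigm; NOT a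
claim that NS blows up. Everything here concerns the five-mode truncation (5.5) of [Tao2016AveragedNS, §5.5]
(`delayCircuitWith K M ε`) with a CONSTANT diagonal damping `-d * Y`, `dᵢ ∈ [μ, μ + Δ]` (the model of one
shell's dissipation `νλ²` in a stage's clock: uniform part `μ`, spread `Δ`); nothing is proved about the
Navier–Stokes equations.

## What this file adds (cell items DIVERGENCE D43(b)(1) + D44, successor S1c of bp1 gen 18)

`ViscousConjugacyGate.lean` (bp1 gen 17) removed the UNIFORM part `μ` of a diagonal damping exactly: in the
inviscid clock `s` (`t = T_μ(s) = -log(1 - μs)/μ`) and after the unshrinking `(1 - μs)⁻¹`, a solution of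
`Ẏ = F(Y) - μY` becomes a solution of `Ż = F(Z)`. For NON-uniform constant rates `d = μ + (d - μ)` the same
conjugation leaves a RESIDUAL, TIME-DEPENDENT diagonal damping

  `Z(s) := (1 - μs)⁻¹ Y(T_μ s)`  solves  `Ż(s) = F(Z(s)) - E(s) * Z(s)`,  `Eᵢ(s) = (dᵢ - μ)/(1 - μs)`

(`hasDerivAt_conj`), and `0 ≤ Eᵢ(s) ≤ Δ/(1 - 2μ)` on the window `s ∈ [0, 2]` when `μ ≤ 1/4`
(`conjRate_bounds`). This is exactly a damping profile admitted by `DampedTransition.quietPhase` (whose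
hypotheses are local in time for this purpose), so: **for constant rates `dᵢ ∈ [μ, μ + Δ]` with
`0 < μ ≤ 1/4` and spread `Δ ≤ (1 - 2μ)/100`, the quiet phase and the critical-time window of Theorem 5.3 hold
for the conjugated trajectory `Z` with `η = Δ/(1 - 2μ)`** (`quietPhase_visc`), i.e. in original variables
`Y(T_μ s) = (1 - μs) • Z(s)` (`unconj`): the viscous gate's trigger reaches the (shrunk) level
`(1 - μ t_c) K⁻¹⁰ε²` at viscous time `T_μ(t_c)` with `2 - 24 log K/M - 18η ≤ t_c² ≤ 2 + 2/M + 20η`.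

* `hasDerivAt_undamp` — the backward conjugacy of `ViscousConjugacy.lean` for TWO-SIDED derivatives (the
  tree has the right-derivative form `hasDerivWithinAt_undamp` only).
* `hasDerivAt_conj`, `conjRate_bounds`, `conj_zero`, `unconj` — the residual damping and its bounds.
* `quietPhase_visc` — THE COROLLARY.

What is NOT claimed: the firing phase (successor S1b); time-dependent or non-diagonal dissipation in
original time (only constant diagonal rates are conjugated here; `quietPhase` itself allows any profile);
anything about Navier–Stokes. [cite: Tao2016AveragedNS, §5.5 Thm 5.3, (5.5); §6 (dissipation outrun by
the cascade's clock)]; the conjugacy is elementary [folklore]. No named facts; 0 sorry.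
-/

noncomputable section

namespace Summit.NavierStokesRegularity.FluidComputer

open Real Set Filter Topology
open Literature.Analysis.FluidPDE.Tao2016AveragedNS
open Literature.Analysis.FluidPDE.Tao2016AveragedNS.Thm53 (init_c)
open ViscousConjugacy (viscTime hasDerivAt_viscTime viscTime_le_viscTime viscTime_nonneg)

namespace DampedTransition

/-! ## §4.1 The backward conjugacy for two-sided derivatives -/

section Undamp

variable {O : Type*} [NormedAddCommGroup O] [NormedSpace ℝ O] {μ : ℝ}

/-- **Backward conjugacy (two-sided).** If `y` has derivative `W` at `T_μ(s)` (`μ ≠ 0`, `μs < 1`) then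
`r ↦ (1 - μr)⁻¹ • y (T_μ r)` has derivative `(1 - μs)⁻² • (W + μ • y (T_μ s))` at `s`
(cf. `ViscousConjugacy.hasDerivWithinAt_undamp`, the right-derivative form). [folklore] -/
theorem hasDerivAt_undamp (hμ : μ ≠ 0) {y : ℝ → O} {W : O} {s : ℝ} (hs : μ * s < 1)
    (hy : HasDerivAt y W (viscTime μ s)) :
    HasDerivAt (fun r => (1 - μ * r)⁻¹ • y (viscTime μ r))
      (((1 - μ * s)⁻¹) ^ 2 • (W + μ • y (viscTime μ s))) s := by
  have hq : 0 < 1 - μ * s := by linarith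
  have hc : HasDerivAt (y ∘ viscTime μ) ((1 - μ * s)⁻¹ • W) s :=
    hy.scomp s (hasDerivAt_viscTime hμ hs)
  have h1 : HasDerivAt (fun r : ℝ => 1 - μ * r) (-μ) s := by
    simpa using ((hasDerivAt_id s).const_mul μ).const_sub 1
  have hi : HasDerivAt (fun r : ℝ => (1 - μ * r)⁻¹) (-(-μ) / (1 - μ * s) ^ 2) s := h1.inv hq.ne'
  have h := hi.smul hc
  refine h.congr_deriv ?_
  simp only [Function.comp_apply]
  have e1 : -(-μ) / (1 - μ * s) ^ 2 = (1 - μ * s)⁻¹ ^ 2 * μ := by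
    field_simp
  rw [e1]
  module

end Undamp

/-! ## §4.2 Constant non-uniform rates: the residual damping after conjugation -/

section Rates

variable {K M ε μ Δ : ℝ} {d : Fin 5 → ℝ} {Y : ℝ → Fin 5 → ℝ}

/-- **The residual damping.** If `Y` solves `Ẏ = delayCircuitWith K M ε Y - d * Y` (constant diagonal
rates `d`) at the viscous time `T_μ(s)`, `μ ≠ 0`, `μs < 1`, then `Z(r) := (1 - μr)⁻¹ • Y(T_μ r)` solves, at
`s`, `Ż = delayCircuitWith K M ε Z - E(s) * Z` with `Eᵢ(s) = (1 - μs)⁻¹ (dᵢ - μ)` (homogeneity of the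
member, `delayCircuitWith_smul`). [cite: Tao2016AveragedNS, §5.5 (5.5); Remark 6.1 (scaling)] -/
theorem hasDerivAt_conj (hμ : μ ≠ 0) {s : ℝ} (hs : μ * s < 1)
    (hY : HasDerivAt Y (delayCircuitWith K M ε (Y (viscTime μ s)) - d * Y (viscTime μ s)) (viscTime μ s)) :
    HasDerivAt (fun r => (1 - μ * r)⁻¹ • Y (viscTime μ r))
      (delayCircuitWith K M ε ((1 - μ * s)⁻¹ • Y (viscTime μ s))
        - (fun i => (1 - μ * s)⁻¹ * (d i - μ)) * ((1 - μ * s)⁻¹ • Y (viscTime μ s))) s := by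
  refine (hasDerivAt_undamp hμ hs hY).congr_deriv ?_
  rw [delayCircuitWith_smul]
  funext i
  simp only [Pi.smul_apply, Pi.sub_apply, Pi.add_apply, Pi.mul_apply, smul_eq_mul]
  ring

/-- The residual rates on the window: `0 ≤ Eᵢ(s) = (1 - μs)⁻¹(dᵢ - μ) ≤ Δ/(1 - 2μ)` for `s ∈ [0,2]`,
`0 < μ ≤ 1/4`, `dᵢ ∈ [μ, μ + Δ]`. [folklore] -/
theorem conjRate_bounds (hμ : 0 < μ) (hμ4 : μ ≤ 1 / 4) (hd : ∀ i, μ ≤ d i ∧ d i ≤ μ + Δ)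
    {s : ℝ} (hs : s ∈ Icc (0:ℝ) 2) (i : Fin 5) :
    0 ≤ (1 - μ * s)⁻¹ * (d i - μ) ∧ (1 - μ * s)⁻¹ * (d i - μ) ≤ Δ / (1 - 2 * μ) := by
  have hq : 1 - 2 * μ ≤ 1 - μ * s := by nlinarith [hs.1, hs.2]
  have hq0 : 0 < 1 - 2 * μ := by linarith
  have hq1 : 0 < 1 - μ * s := lt_of_lt_of_le hq0 hq
  have hdi : 0 ≤ d i - μ := by linarith [(hd i).1]
  have hdi' : d i - μ ≤ Δ := by linarith [(hd i).2]
  refine ⟨mul_nonneg (inv_nonneg.2 hq1.le) hdi, ?_⟩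
  rw [inv_mul_eq_div, div_le_div_iff₀ hq1 hq0]
  calc (d i - μ) * (1 - 2 * μ) ≤ Δ * (1 - 2 * μ) := mul_le_mul_of_nonneg_right hdi' hq0.le
    _ ≤ Δ * (1 - μ * s) := mul_le_mul_of_nonneg_left hq (hdi.trans hdi')

/-- The conjugated trajectory starts at the same datum: `Z(0) = Y(0)` (`T_μ(0) = 0`). [folklore] -/
theorem conj_zero (μ : ℝ) (Y : ℝ → Fin 5 → ℝ) :
    (fun r => (1 - μ * r)⁻¹ • Y (viscTime μ r)) 0 = Y 0 := by
  simp [viscTime]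

/-- Back to original variables: `Y(T_μ s) = (1 - μs) • Z(s)` for `μs < 1`. [folklore] -/
theorem unconj {s : ℝ} (hs : μ * s < 1) (Y : ℝ → Fin 5 → ℝ) :
    Y (viscTime μ s) = (1 - μ * s) • (fun r => (1 - μ * r)⁻¹ • Y (viscTime μ r)) s := by
  have hq : (1 - μ * s) ≠ 0 := by
    have : 0 < 1 - μ * s := by linarith
    exact this.ne'
  simp only [smul_smul, mul_inv_cancel₀ hq, one_smul]

/-- **THE COROLLARY (quiet phase of the viscous gate with constant non-uniform rates).** Let
`0 < μ ≤ 1/4`, `dᵢ ∈ [μ, μ + Δ]` with spread `Δ ≤ (1 - 2μ)/100`, and let `Y` solve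
`Ẏ = delayCircuitWith K M ε Y - d * Y` on the viscous window `[0, T_μ(2)]` from `Y(0) = (1,0,0,0,0)`, under the
standing hypotheses of `quietPhase` on `K, M, ε`. Then the conjugated trajectory
`Z(s) = (1 - μs)⁻¹ • Y(T_μ s)` has the quiet phase and the critical-time window of [Tao2016AveragedNS, Thm 5.3]
with `η = Δ/(1 - 2μ)`: there is `t_c ∈ [1, 3/2]`, `2 - 24 log K/M - 18η ≤ t_c² ≤ 2 + 2/M + 20η`, with
`Z(t_c)₂ = K⁻¹⁰ε²` and, on `[0, t_c]`, `0 ≤ c ≤ K⁻¹⁰ε²`, `|a - 1| ≤ 8K⁻²⁰ + 2η`, `|b - εs| ≤ (17K⁻²⁰ + 9η)εs`,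
`|d|, |ã| ≤ 3K⁻¹⁰` (read in original variables through `unconj`).
[cite: Tao2016AveragedNS, §5.5 Thm 5.3, (tcable), (c-bound); §6] -/
theorem quietPhase_visc (hμ : 0 < μ) (hμ4 : μ ≤ 1 / 4) (hd : ∀ i, μ ≤ d i ∧ d i ≤ μ + Δ)
    (hY : ∀ t ∈ Icc 0 (viscTime μ 2), HasDerivAt Y (delayCircuitWith K M ε (Y t) - d * Y t) t)
    (h0 : Y 0 = delayInit) (hε : 0 < ε) (hε1 : ε ≤ 1) (hM0 : 0 < M) (hMK : M ≤ K ^ 10) (hK : 16 ≤ K)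
    (hML : 48 * Real.log K ≤ M) (hεK : ε ^ 2 ≤ 1 / (6 * K ^ 20)) (hΔ : Δ / (1 - 2 * μ) ≤ 1 / 100) :
    ∃ τ : ℝ, (2 - 24 * Real.log K / M - 18 * (Δ / (1 - 2 * μ)) ≤ τ ^ 2 ∧
        τ ^ 2 ≤ 2 + 2 / M + 20 * (Δ / (1 - 2 * μ)) ∧ 1 ≤ τ ∧ τ ≤ 3 / 2) ∧
      (fun r => (1 - μ * r)⁻¹ • Y (viscTime μ r)) τ 2 = ε ^ 2 / K ^ 10 ∧
      ∀ s ∈ Icc 0 τ,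
        (0 ≤ (fun r => (1 - μ * r)⁻¹ • Y (viscTime μ r)) s 2 ∧
          (fun r => (1 - μ * r)⁻¹ • Y (viscTime μ r)) s 2 ≤ ε ^ 2 / K ^ 10) ∧
        |(fun r => (1 - μ * r)⁻¹ • Y (viscTime μ r)) s 0 - 1| ≤ 8 / K ^ 20 + 2 * (Δ / (1 - 2 * μ)) ∧
        |(fun r => (1 - μ * r)⁻¹ • Y (viscTime μ r)) s 1 - ε * s|
            ≤ (17 / K ^ 20 + 9 * (Δ / (1 - 2 * μ))) * ε * s ∧
        |(fun r => (1 - μ * r)⁻¹ • Y (viscTime μ r)) s 3| ≤ 3 / K ^ 10 ∧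
        |(fun r => (1 - μ * r)⁻¹ • Y (viscTime μ r)) s 4| ≤ 3 / K ^ 10 := by
  have h2μ : μ * 2 < 1 := by linarith
  -- the conjugated trajectory solves the damped member with rates `E(s) = (1 - μs)⁻¹ (d - μ)` on `[0,2]`
  have hX : ∀ s ∈ Icc (0:ℝ) 2, HasDerivAt (fun r => (1 - μ * r)⁻¹ • Y (viscTime μ r))
      (delayCircuitWith K M ε ((fun r => (1 - μ * r)⁻¹ • Y (viscTime μ r)) s)
        - (fun r : ℝ => fun i : Fin 5 => (1 - μ * r)⁻¹ * (d i - μ)) s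
          * (fun r => (1 - μ * r)⁻¹ • Y (viscTime μ r)) s) s := by
    intro s hs
    have hμs : μ * s < 1 := by nlinarith [hs.2, hμ]
    have hTs : viscTime μ s ∈ Icc 0 (viscTime μ 2) :=
      ⟨viscTime_nonneg hμ hs.1 hμs, viscTime_le_viscTime hμ hs.2 h2μ⟩
    exact hasDerivAt_conj hμ.ne' hμs (hY _ hTs)
  have hE : ∀ s ∈ Icc (0:ℝ) 2, ∀ i,
      0 ≤ (fun r : ℝ => fun i : Fin 5 => (1 - μ * r)⁻¹ * (d i - μ)) s i ∧
        (fun r : ℝ => fun i : Fin 5 => (1 - μ * r)⁻¹ * (d i - μ)) s i ≤ Δ / (1 - 2 * μ) :=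
    fun s hs i => conjRate_bounds hμ hμ4 hd hs i
  have hZ0 : (fun r => (1 - μ * r)⁻¹ • Y (viscTime μ r)) 0 = delayInit := by rw [conj_zero, h0]
  exact quietPhase hX hE hZ0 hε hε1 hM0 hMK hK hML hεK hΔ

end Rates

end DampedTransition

end Summit.NavierStokesRegularity.FluidComputer
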